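import Summits.Ventures.HSemireg.VerdictAssemblyG6
import Summits.Ventures.HSemireg.AmplificationChainG2nTransport
import Summits.Ventures.HSemireg.S4BridgeSplitPointLadderSchoen
import HarnessLib

/-!
# Venture HSemireg — the DECIDING rows are LADDER rows: ONE seed on a member of ANY component `(N, K, δ)` — split or not — gives that
# component (Deligne's reach-by-similitude + the transfer assumption) AND, by Schoen's Proposition ITERATED (tree THEOREMS, no named
# fact), EVERY component `(n, K, δ')` and `WeilAlgebraicAll n d` for every `1 ≤ n < N`; § g = 6 ∕ § g = 8 ∕ § g = 10 re-read accordingly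

HONEST FRAMING. Assembly leaf of a COMPUTATION cell (`pub-hsemireg`, Sunday typer seat p11 «assembly, g = 2n», third generation; referees
ref-3 ∕ ref-4; companions `AmplificationChainG2n.lean` (p353612), `StructureLadderG2n.lean` (p356325), `VerdictAssemblyG6.lean` (p362467)).
It WIRES, without restating, (i) the level-`N` DECIDING-ROW form of the amplification chain (`ComponentCellsRouteC.lean`'s
`weilClassesComponent_of_localVariationalHodgeFor_of_seedOn_member`: a seed of an admissible object class `𝒪` on a polarized member
`(P, ψ₀, h_K)` of the component `(N, d, δ)` ⟹ `WeilClassesComponent N d δ`, BY NAME Deligne's reach-by-similitude `weilFamilyReach_similar`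
and the door-agnostic transfer statement `LocalVariationalHodgeFor 𝒪`) with (ii) the S4-PUSH cell's bridge (B2) in Schoen's CLASS-AGNOSTIC
ladder form (`S4BridgeSplitPointLadderSchoen.lean`, seat s4-bridge-2: `weilClassesComponent_of_component_add` — ONE component `(n + k + 1, d, f)`
of ANY class `f` with `sign f = (-1)^{n+k+1}` decides EVERY component `(n, d, δ')` — and `weilAlgebraicAll_of_component_succ`; 0 named fact:
Schoen's transfer and Lefschetz `(1,1)` are PROVED tree theorems) and (iii) the sign law `weilSign_eq_of_hasWeilDiscriminantNondeg` (ring 2: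
a member of Weil type `(N, d)` forces `sign δ = (-1)^N`). NOTHING about any explicit variety is asserted; every published input is a
hypothesis BY NAME, every object a hypothesis BY VALUE; nothing here says HC, HC_CM or HC_AV is proved. 0 `sorry`, 0 `def`, 0 new named
fact; every theorem is an IMPLICATION whose object-side binders NO census row of record discharges on any deciding component (signed
`target-g6/VERDICT-G6.md` v1.0 `1651dcc7322662a2`: g = 6 non-split «NO-in-families-tried», g = 8 «NO-in-families-tried», g = 10 ∕ family S
«no witness»; STRUCTURAL-NO not claimed).

## What is new relative to the companions

p11 g0's LADDER (`ladder_of_reach_of_perfectComplexRankTransfer_of_complex`, every `N`) starts from a seed on a SPLIT (hyperbolic) `2N`-fold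
and descends by `stub_descend` (split `2(n+1)`-folds ⟹ all `2n`-folds), BY NAME `weilFamilyReach_hyperbolic`; its DECIDING-ROW form
(`weilClassesComponent_of_perfectComplexRankTransfer_of_complex`) stops at the member's own component. Here the two are joined: since
2026-08-23 the tree holds Schoen's Proposition for an upper component of ARBITRARY class (s4-bridge-2), so a deciding-row seed on a
NON-split component `(N, d, δ)` is ALSO a ladder seed — it gives `(N, d, δ)` itself and then every `(n, d, δ')`, `1 ≤ n < N`, with NO
reach and NO transfer hypothesis below level `N`. This is the kernel form of the cell's word «DECIDING» for the g = 8 rows (coordinator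
2026-08-22T11:35:35Z (2): «the NON-SPLIT g = 6 components and ALL g = 8 rows are DECIDING»): a passing n = 4 row on ANY eightfold component
would have given every SIXFOLD component `(3, K, δ')` — the non-split g = 6 cells — and every fourfold. BY NAME only
`weilFamilyReach_similar` (Deligne, REFEREED; [Deligne1982HodgeCycles] proof of Thm. 4.8, [vanGeemen1994HodgeAV] 5.3–5.5) and
`LocalVariationalHodgeFor 𝒪` (for route (C): `PerfectComplexRankTransfer C` ∕ `PerfectComplexSigmaTransfer C` — ASSUMPTIONS of the
venture, no kernel link to their printed legs — or Pridham's printed statement `PridhamPerfectLifts C` + `PerfectComplexAlgebraisesLifts C`).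

## Contents

§1 class-target bookkeeping (no seed): ONE component of the right sign at level `N` ⟹ every component below and `WeilAlgebraicAll n d`,
`1 ≤ n < N`. §2 THE COMPONENT LADDER from a seed on a member, door-agnostic. §3 route (C) on real carriers: rank door, σ-door, gluable
σ-class. §4 readings by `g` (`N = 3, 4, 5, 6`). §5 the signed § g = 6 ∕ § g = 8 ∕ § g = 10 words as ONE conjunction each: the certified
negative over the census of record (`CensusG6.outcome_g6`, `CensusG8.outcome_g8`, `CensusG10.no_semireg_and_class_at_g10`, kernel data of
seats p11 ∕ p9) ∧ what ONE seed on a member of ANY component at that level WOULD have given.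

References: [Schoen1998HodgeWeilAddendum] ¶10 (Proposition, p. 332; proof pp. 332–333); [Deligne1982HodgeCycles] proof of Thm. 4.8;
[vanGeemen1994HodgeAV] 4.14, Lemma 5.2, 5.3–5.5; [Markman2025SurveySecant] arXiv:2509.23403 §11.5 Steps 1–2, §12 (preprint);
[Markman2025SecantWeil] arXiv:2502.03415 Thm. 1.5.1, Cor. 1.6.1 (preprint); [BuchweitzFlenner2008HH] Prop. 6.4.4; [BuchweitzFlenner2003]
Def. 4.1, §5; [Perry2022] Prop. 8.1; [Pridham2024Semiregularity] Cor. 2.25, Rem. 2.27; [VoisinHodgeI2002] Thm. 11.30.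
-/

noncomputable section

open CategoryTheory CategoryTheory.Limits AlgebraicGeometry Set
open Literature.AlgebraicGeometry Literature.AlgebraicGeometry.Motives Literature.AlgebraicGeometry.Modules
open Literature.AlgebraicGeometry.HodgeTheory Literature.AlgebraicGeometry.KTheory
open Literature.AlgebraicGeometry.ModuliOfAbelianVarieties Literature.AlgebraicGeometry.Deligne1982
open Literature.AlgebraicGeometry.VanGeemen1994
open Literature.AlgebraicTopology.SingularHomology

namespace Summit.Ventures.HSemireg

open Summit.HodgeConjecture.HodgeConjecture
open Summit.HodgeConjecture.HodgeConjecture.WeilTypeLadder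
open Summit.HodgeConjecture.HodgeConjecture.Cruxes.HodgeAbelianVarieties.EStepSecantInduction
open Summit.HodgeConjecture.HodgeConjecture.Ring2.Hypotheses
open Summit.HodgeConjecture.HodgeConjecture.Ring2.AbelianAll
open Summit.Ventures.HSemireg.GeneralStructure

/-! ## §1 Class-target bookkeeping: ONE component of the right sign at level `N` decides everything below (Schoen's Proposition iterated) -/

section Below

/-- **ONE component `(N, d, f)` with `sign f = (-1)^N` decides EVERY component `(n, d, δ)`, `1 ≤ n < N`** — s4-bridge-2's
`weilClassesComponent_of_component_add` (Schoen's ¶10 Proposition iterated, typed for all ranks; partner surfaces from bridge (B2), their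
Weil classes by Lefschetz `(1,1)` — all tree THEOREMS) re-indexed by the gap `k = N - n - 1`. An implication between the OPEN typed class
targets `Ring2.Hypotheses.WeilClassesComponent`; nothing is asserted. [cite: Schoen1998HodgeWeilAddendum, 10 (Proposition), p. 332]
[cite: vanGeemen1994HodgeAV, 4.14 and Lemma 5.2 (4)] -/
theorem weilClassesComponent_lt_of_weilClassesComponent {N d : ℕ} (hd : 0 < d) {f : weilNormResidueGroup d}
    (hf : weilSign d f = (-1) ^ N) (h : WeilClassesComponent N d f) {n : ℕ} (hn : 0 < n) (hnN : n < N)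
    (δ : weilNormResidueGroup d) : WeilClassesComponent n d δ := by
  obtain ⟨k, rfl⟩ : ∃ k : ℕ, N = n + k + 1 := ⟨N - n - 1, by omega⟩
  exact weilClassesComponent_of_component_add hn hd k hf h δ

/-- **… and `WeilAlgebraicAll n d` for every `1 ≤ n < N`** (every rational `(n,n)` Weil class of EVERY `(A, φ)` with `φ ≫ φ = -d`,
polarisation not in the data): the rung `n + 1 ≤ N` is either the given component (`n + 1 = N`) or the SPLIT class `[(-1)^{n+1}]` there
(`weilSign_mk_neg_one_pow`), decided by the previous theorem; then s4-bridge-2's component-free form `weilAlgebraicAll_of_component_succ`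
(van Geemen Lemma 5.2 (1)–(3): every `(A, φ)` carries SOME class `δ`). [cite: Schoen1998HodgeWeilAddendum, 10 (Proposition), p. 332]
[cite: vanGeemen1994HodgeAV, Lemma 5.2 (1)–(4)] -/
theorem weilAlgebraicAll_lt_of_weilClassesComponent {N d : ℕ} (hd : 0 < d) {f : weilNormResidueGroup d}
    (hf : weilSign d f = (-1) ^ N) (h : WeilClassesComponent N d f) {n : ℕ} (hn : 0 < n) (hnN : n < N) :
    WeilAlgebraicAll n d := by
  rcases Nat.lt_or_ge (n + 1) N with hlt | hge
  · exact weilAlgebraicAll_of_component_succ hn hd (weilSign_mk_neg_one_pow d (n + 1))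
      (weilClassesComponent_lt_of_weilClassesComponent hd hf h (Nat.succ_pos n) hlt _)
  · obtain rfl : N = n + 1 := le_antisymm hge hnN
    exact weilAlgebraicAll_of_component_succ hn hd hf h

/-- **Both at once, member reading included**: from ONE component `(N, d, f)` of the right sign, for every `1 ≤ n < N` every component
`(n, d, δ)`, `WeilAlgebraicAll n d`, and — van Geemen 4.9's member wording — the whole complexified Weil plane of every `(A, φ)` of Weil
type `(n, d)` lies in the algebraic classes. [cite: Schoen1998HodgeWeilAddendum, 10 (Proposition), p. 332]
[cite: vanGeemen1994HodgeAV, 4.9 and Lemma 5.2] -/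
theorem below_of_weilClassesComponent {N d : ℕ} (hd : 0 < d) {f : weilNormResidueGroup d}
    (hf : weilSign d f = (-1) ^ N) (h : WeilClassesComponent N d f) {n : ℕ} (hn : 0 < n) (hnN : n < N) :
    (∀ δ : weilNormResidueGroup d, WeilClassesComponent n d δ) ∧ WeilAlgebraicAll n d ∧
      ∀ (A : AbelianVariety ℂ) (φ : A ⟶ A), IsWeilType A φ n d → weilClassesOf A φ n d ≤ algebraicClasses A.X n :=
  have hA : WeilAlgebraicAll n d := weilAlgebraicAll_lt_of_weilClassesComponent hd hf h hn hnN
  ⟨fun δ ↦ weilClassesComponent_lt_of_weilClassesComponent hd hf h hn hnN δ, hA,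
    fun A φ hW ↦ hW.weilClassesOf_le_algebraicClasses (hA A φ hW.dim_eq hW.sq_eq)⟩

end Below

/-! ## §2 THE COMPONENT LADDER from ONE seed on a member of ANY component (door-agnostic) -/

section Member

variable {𝒪 : ObjClass}

/-- **THE COMPONENT LADDER, every level `N ≥ 1`, door-agnostic.** BY NAME: Deligne's reach-by-similitude `weilFamilyReach_similar`
(REFEREED named fact) and the transfer statement `LocalVariationalHodgeFor 𝒪` of the admissible object class `𝒪` (door-agnostic
hypothesis; for the cell's doors see §3). BY VALUE: a polarized member `(P, ψ₀, h_K = symmetrisedClass d P ψ₀ e a)` of Weil type `(N, d)`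
of the component `(N, d, δ)` (`HasWeilDiscriminantNondeg`, van Geemen's `det H = δ`; split OR non-split), a non-zero rational Weil class
`w` on it, and ONE seed of class `𝒪` there (`HasSeedOn 𝒪 N P h_K w`: `κ_N = q·h_Kᴺ + w`, `κ_p = c_p·h_Kᵖ`). CONCLUSION: (i)
`WeilClassesComponent N d δ` — the Weil classes of EVERY member of the member's own component are algebraic (the deciding-row form,
`weilClassesComponent_of_localVariationalHodgeFor_of_seedOn_member`); (ii) for every `1 ≤ n < N` and EVERY class `δ'`,
`WeilClassesComponent n d δ'`; (iii) for every `1 ≤ n < N`, `WeilAlgebraicAll n d`. The descent (ii)–(iii) uses NO named fact: the member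
forces `sign δ = (-1)^N` (`weilSign_eq_of_hasWeilDiscriminantNondeg`) and §1 applies. At `N = 2, 3` the conclusion is print territory
re-derived ([Markman2023GeneralizedKummers] Thm. 1.5 ∕ [Markman2025SecantWeil] Thm. 1.5.1, Cor. 1.6.1 for split members; Schoen ¶10 for the descent); for a NON-split
member at `N = 3` and for every member at `N ≥ 4` it is an implication with no printed instance and, by the signed verdict, no census
object. [cite: Deligne1982HodgeCycles, proof of Thm. 4.8] [cite: Schoen1998HodgeWeilAddendum, 10 (Proposition), p. 332]
[cite: vanGeemen1994HodgeAV, Lemma 5.2 (3)–(4) and Thm. 5.3] [cite: Markman2025SurveySecant, §11.5 Steps 1–2 (preprint)] -/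
theorem componentLadder_of_localVariationalHodgeFor_of_seedOn_member (hF : weilFamilyReach_similar)
    (hT : LocalVariationalHodgeFor 𝒪) {N d : ℕ} {δ : weilNormResidueGroup d}
    {P : AbelianVariety ℂ} {ψ₀ : P ⟶ P} (hW : IsWeilType P ψ₀ N d) (e : ProjectiveEmbedding P.X)
    {a : complexBetti (projectiveSpace e.n ℂ) 2} (haQ : IsRationalClass a) (ha0 : a ≠ 0)
    (hδ : HasWeilDiscriminantNondeg P ψ₀ N d (symmetrisedClass d P ψ₀ e a) δ)
    {w : complexBetti P.X (2 * N)} (hwW : w ∈ weilClassesOf P ψ₀ N d) (hwQ : IsRationalClass w) (hw0 : w ≠ 0)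
    (hS : HasSeedOn 𝒪 N P (symmetrisedClass d P ψ₀ e a) w) :
    WeilClassesComponent N d δ ∧
      (∀ n : ℕ, 0 < n → n < N → ∀ δ' : weilNormResidueGroup d, WeilClassesComponent n d δ') ∧
      ∀ n : ℕ, 0 < n → n < N → WeilAlgebraicAll n d :=
  have hC : WeilClassesComponent N d δ :=
    weilClassesComponent_of_localVariationalHodgeFor_of_seedOn_member hF hT hW e haQ ha0 hδ hwW hwQ hw0 hS
  have hsgn : weilSign d δ = (-1) ^ N := weilSign_eq_of_hasWeilDiscriminantNondeg hW e haQ ha0 hδ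
  ⟨hC, fun _ hn hnN δ' ↦ weilClassesComponent_lt_of_weilClassesComponent hW.d_pos hsgn hC hn hnN δ',
    fun _ hn hnN ↦ weilAlgebraicAll_lt_of_weilClassesComponent hW.d_pos hsgn hC hn hnN⟩

end Member

/-! ## §3 Route (C) on real carriers: the component ladder at the rank door, the σ-door and the gluable σ-class -/

section RouteC

variable (C : ChernCharacterBetti)

/-- **The component ladder, route (C), RANK DOOR — every binder a real carrier.** BY NAME: `weilFamilyReach_similar` (REFEREED) and
`PerfectComplexRankTransfer C` (ASSUMPTION of the venture for seat p4's real rank class; printed legs [BuchweitzFlenner2008HH] Prop. 6.4.4,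
[Perry2022] Prop. 8.1 ∕ [Pridham2024Semiregularity] Cor. 2.25 ON PAPER, no kernel link). BY VALUE: a polarized member `(P, ψ₀, h_K)` of Weil
type `(N, d)` of the component `(N, d, δ)`, `w ≠ 0` rational Weil, `I ⊇ {1, …, 2N}`, ONE bounded complex of vector bundles `E` on `P.X` with
`Ext^{<0}(E,E) = 0`, `Hom(E,E) = ℂ`, `rank Ext²(E,E) ≤ r(P, ch E)` (the rank certificate) and Markman's class shape `ch_N(E) = q·h_Kᴺ + w`,
`ch_p(E) = c_p·h_Kᵖ` off `N`. CONCLUSION: the member's component ∧ every component and `WeilAlgebraicAll` at every level `1 ≤ n < N`.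
p11 g0's `weilClassesComponent_of_perfectComplexRankTransfer_of_complex` is conjunct (i). [cite: BuchweitzFlenner2008HH, Prop. 6.4.4]
[cite: Perry2022, Prop. 8.1] [cite: Deligne1982HodgeCycles, proof of Thm. 4.8] [cite: Schoen1998HodgeWeilAddendum, 10 (Proposition), p. 332]
[cite: Markman2025SecantWeil, §1.3 and Cor. 1.3.2 (the class shape; preprint)] -/
theorem componentLadder_of_perfectComplexRankTransfer_of_complex_member {N d : ℕ} {δ : weilNormResidueGroup d}
    (hF : weilFamilyReach_similar) (hT : PerfectComplexRankTransfer C)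
    {P : AbelianVariety ℂ} {ψ₀ : P ⟶ P} (hW : IsWeilType P ψ₀ N d) (e : ProjectiveEmbedding P.X)
    {a : complexBetti (projectiveSpace e.n ℂ) 2} (haQ : IsRationalClass a) (ha0 : a ≠ 0)
    (hδ : HasWeilDiscriminantNondeg P ψ₀ N d (symmetrisedClass d P ψ₀ e a) δ)
    (w : complexBetti P.X (2 * N)) (hwW : w ∈ weilClassesOf P ψ₀ N d) (hwQ : IsRationalClass w) (hw0 : w ≠ 0)
    (I : Finset ℕ) (hI : ∀ p : ℕ, 1 ≤ p → p ≤ 2 * N → p ∈ I) (E : CochainComplex P.X.left.Modules ℤ)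
    (hE : IsBoundedVBComplex E) (hneg : ∀ k : ℤ, k < 0 → extRank P.X E k = 0) (h0 : extRank P.X E 0 = 1)
    (h2 : extRank P.X E 2 ≤ Cardinal.lift.{1} (contractionRank P fun p ↦ chPerfect C P.X E hE.isFiniteLocallyFree p))
    (q : ℚ) (c : ℕ → ℚ)
    (hchN : chPerfect C P.X E hE.isFiniteLocallyFree N = ((q : ℚ) : ℂ) • cupPowTwo (symmetrisedClass d P ψ₀ e a) N + w)
    (hchp : ∀ p ∈ I, p ≠ N →
      chPerfect C P.X E hE.isFiniteLocallyFree p = ((c p : ℚ) : ℂ) • cupPowTwo (symmetrisedClass d P ψ₀ e a) p) :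
    WeilClassesComponent N d δ ∧
      (∀ n : ℕ, 0 < n → n < N → ∀ δ' : weilNormResidueGroup d, WeilClassesComponent n d δ') ∧
      ∀ n : ℕ, 0 < n → n < N → WeilAlgebraicAll n d :=
  componentLadder_of_localVariationalHodgeFor_of_seedOn_member hF hT.localVariationalHodgeFor hW e haQ ha0 hδ hwW hwQ hw0
    (hasSeedOn_rankObjClass_of_complex hW.pos P hW.dim_eq _ w I hI E hE hneg h0 h2 q c hchN hchp)

/-- **The component ladder, route (C), σ-DOOR** (target seat t-7's `sigmaObjClass C`; the certificate is SEMIREGULARITY itself on the real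
carrier: `E` concentrated in `[a', b']`, `(σ_q(E))_{q+1 ∈ I}` JOINTLY INJECTIVE, `HomComplex.IsISemiregularC`). BY NAME:
`weilFamilyReach_similar` (REFEREED) and `PerfectComplexSigmaTransfer C` (ASSUMPTION; claim-grade printed shape [Perry2026] Thm. 1.1, refereed
chain [Perry2022] Prop. 8.1 + [Pridham2024Semiregularity] + [Lieblich2006]; no kernel link). BY VALUE: the member, `w`, `I`, ONE bounded
complex of vector bundles with `Ext^{<0} = 0`, `Hom = ℂ`, the σ-certificate and the class shape. CONCLUSION as at the rank door.
[cite: BuchweitzFlenner2003, Def. 4.1 and §5 (I-semiregular)] [cite: Perry2022, Prop. 8.1] [cite: Deligne1982HodgeCycles, proof of Thm. 4.8]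
[cite: Schoen1998HodgeWeilAddendum, 10 (Proposition), p. 332] -/
theorem componentLadder_of_perfectComplexSigmaTransfer_of_complex_member {N d : ℕ} {δ : weilNormResidueGroup d}
    (hF : weilFamilyReach_similar) (hT : PerfectComplexSigmaTransfer C)
    {P : AbelianVariety ℂ} {ψ₀ : P ⟶ P} (hW : IsWeilType P ψ₀ N d) (e : ProjectiveEmbedding P.X)
    {a : complexBetti (projectiveSpace e.n ℂ) 2} (haQ : IsRationalClass a) (ha0 : a ≠ 0)
    (hδ : HasWeilDiscriminantNondeg P ψ₀ N d (symmetrisedClass d P ψ₀ e a) δ)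
    (w : complexBetti P.X (2 * N)) (hwW : w ∈ weilClassesOf P ψ₀ N d) (hwQ : IsRationalClass w) (hw0 : w ≠ 0)
    (I : Finset ℕ) (hI : ∀ p : ℕ, 1 ≤ p → p ≤ 2 * N → p ∈ I) (E : CochainComplex P.X.left.Modules ℤ)
    (hE : IsBoundedVBComplex E) (hneg : ∀ k : ℤ, k < 0 → extRank P.X E k = 0) (h0 : extRank P.X E 0 = 1)
    (a' b' : ℤ) [E.IsStrictlyGE a'] [E.IsStrictlyLE b']
    (hσ : letI := HasDerivedCategory.standard P.X.left.Modules
      HomComplex.IsISemiregularC P.X E a' b' hE.isFiniteLocallyFree {q | q + 1 ∈ I})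
    (q : ℚ) (c : ℕ → ℚ)
    (hchN : chPerfect C P.X E hE.isFiniteLocallyFree N = ((q : ℚ) : ℂ) • cupPowTwo (symmetrisedClass d P ψ₀ e a) N + w)
    (hchp : ∀ p ∈ I, p ≠ N →
      chPerfect C P.X E hE.isFiniteLocallyFree p = ((c p : ℚ) : ℂ) • cupPowTwo (symmetrisedClass d P ψ₀ e a) p) :
    WeilClassesComponent N d δ ∧
      (∀ n : ℕ, 0 < n → n < N → ∀ δ' : weilNormResidueGroup d, WeilClassesComponent n d δ') ∧
      ∀ n : ℕ, 0 < n → n < N → WeilAlgebraicAll n d :=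
  componentLadder_of_localVariationalHodgeFor_of_seedOn_member hF hT.localVariationalHodgeFor hW e haQ ha0 hδ hwW hwQ hw0
    (hasSeedOn_sigmaObjClass_of_complex hW.pos P _ w I hI E hE hneg h0 a' b' hσ q c hchN hchp)

/-- **The component ladder on the GLUABLE σ-class** (`perfectObjClass C gluableSigmaAdmissible`, no `Hom = ℂ`;
`AmplificationChainSigmaGluable.lean`). BY NAME: `weilFamilyReach_similar` (REFEREED), (F) `PridhamPerfectLifts C` (Pridham 2024's printed +
refereed statement typed venture-side on the real σ-carrier; undischarged) and (E)+(C) `PerfectComplexAlgebraisesLifts C` (Hodge-free;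
kernel-linked to nothing). BY VALUE: the member, `w`, `I`, ONE bounded complex of vector bundles with `Ext^{<0} = 0`, the σ-certificate and the
class shape. CONCLUSION as at the rank door. [cite: Pridham2024Semiregularity, Cor. 2.25; Rem. 2.27] [cite: Perry2022, proof of Prop. 8.1]
[cite: Deligne1982HodgeCycles, proof of Thm. 4.8] [cite: Schoen1998HodgeWeilAddendum, 10 (Proposition), p. 332] -/
theorem componentLadder_of_pridhamPerfect_of_algebraisesLifts_of_gluableComplex_member {N d : ℕ} {δ : weilNormResidueGroup d}
    (hF : weilFamilyReach_similar) (hP : PridhamPerfectLifts C) (hA : PerfectComplexAlgebraisesLifts C)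
    {P : AbelianVariety ℂ} {ψ₀ : P ⟶ P} (hW : IsWeilType P ψ₀ N d) (e : ProjectiveEmbedding P.X)
    {a : complexBetti (projectiveSpace e.n ℂ) 2} (haQ : IsRationalClass a) (ha0 : a ≠ 0)
    (hδ : HasWeilDiscriminantNondeg P ψ₀ N d (symmetrisedClass d P ψ₀ e a) δ)
    (w : complexBetti P.X (2 * N)) (hwW : w ∈ weilClassesOf P ψ₀ N d) (hwQ : IsRationalClass w) (hw0 : w ≠ 0)
    (I : Finset ℕ) (hI : ∀ p : ℕ, 1 ≤ p → p ≤ 2 * N → p ∈ I) (E : CochainComplex P.X.left.Modules ℤ)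
    (hE : IsBoundedVBComplex E) (hneg : ∀ k : ℤ, k < 0 → extRank P.X E k = 0)
    (a' b' : ℤ) [E.IsStrictlyGE a'] [E.IsStrictlyLE b']
    (hσ : letI := HasDerivedCategory.standard P.X.left.Modules
      HomComplex.IsISemiregularC P.X E a' b' hE.isFiniteLocallyFree {q | q + 1 ∈ I})
    (q : ℚ) (c : ℕ → ℚ)
    (hchN : chPerfect C P.X E hE.isFiniteLocallyFree N = ((q : ℚ) : ℂ) • cupPowTwo (symmetrisedClass d P ψ₀ e a) N + w)
    (hchp : ∀ p ∈ I, p ≠ N →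
      chPerfect C P.X E hE.isFiniteLocallyFree p = ((c p : ℚ) : ℂ) • cupPowTwo (symmetrisedClass d P ψ₀ e a) p) :
    WeilClassesComponent N d δ ∧
      (∀ n : ℕ, 0 < n → n < N → ∀ δ' : weilNormResidueGroup d, WeilClassesComponent n d δ') ∧
      ∀ n : ℕ, 0 < n → n < N → WeilAlgebraicAll n d :=
  componentLadder_of_localVariationalHodgeFor_of_seedOn_member hF
    (localVariationalHodgeFor_gluable_of_pridhamPerfect_of_algebraisesLifts hP hA) hW e haQ ha0 hδ hwW hwQ hw0
    (hasSeedOn_gluableSigmaObjClass_of_complex hW.pos P _ w I hI E hE hneg a' b' hσ q c hchN hchp)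

end RouteC

/-! ## §4 Readings by `g` (bundled seed on a member of ANY component; `𝒪 = rankObjClass C`, `sigmaObjClass C`, … via §3) -/

section Readings

variable {𝒪 : ObjClass}

/-- **`N = 3` — a DECIDING g = 6 row** (VERDICT-G6 v1.0 V-1: the 134 deciding rows are read on a NON-split sixfold component;
«NO-in-families-tried», candidates 0): a seed on a member of ANY sixfold component `(3, d, δ)` WOULD give that component (every member's
Weil classes) ∧ EVERY ℚ(√−d)-Weil FOURFOLD (`WeilAlgebraicAll 2 d`) ∧ every fourfold cell — the fourfold half is print territory
([Markman2025SecantWeil] Cor. 1.6.1 via [Schoen1998HodgeWeilAddendum] ¶10, preprint + refereed), re-derived with NO split hypothesis on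
the sixfold. [cite: Schoen1998HodgeWeilAddendum, 10 (Proposition), p. 332] [cite: Markman2025SecantWeil, Cor. 1.6.1 (preprint)]
[cite: Deligne1982HodgeCycles, proof of Thm. 4.8] -/
theorem sixfoldComponent_and_fourfolds_of_reach_of_localVariationalHodgeFor_of_seedOn_member (hF : weilFamilyReach_similar)
    (hT : LocalVariationalHodgeFor 𝒪) {d : ℕ} {δ : weilNormResidueGroup d}
    {P : AbelianVariety ℂ} {ψ₀ : P ⟶ P} (hW : IsWeilType P ψ₀ 3 d) (e : ProjectiveEmbedding P.X)
    {a : complexBetti (projectiveSpace e.n ℂ) 2} (haQ : IsRationalClass a) (ha0 : a ≠ 0)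
    (hδ : HasWeilDiscriminantNondeg P ψ₀ 3 d (symmetrisedClass d P ψ₀ e a) δ)
    {w : complexBetti P.X 6} (hwW : w ∈ weilClassesOf P ψ₀ 3 d) (hwQ : IsRationalClass w) (hw0 : w ≠ 0)
    (hS : HasSeedOn 𝒪 3 P (symmetrisedClass d P ψ₀ e a) w) :
    WeilClassesComponent 3 d δ ∧ WeilAlgebraicAll 2 d ∧ ∀ δ' : weilNormResidueGroup d, WeilClassesComponent 2 d δ' :=
  have h := componentLadder_of_localVariationalHodgeFor_of_seedOn_member hF hT hW e haQ ha0 hδ hwW hwQ hw0 hS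
  ⟨h.1, h.2.2 2 two_pos (by norm_num), h.2.1 2 two_pos (by norm_num)⟩

/-- **`N = 4` — a DECIDING g = 8 row** (VERDICT-G6 v1.0 § g = 8: «NO-in-families-tried», 148 ∕ 156 ∕ 158 rows, every row deciding;
STRUCTURE (S3) MOD-4 LAW: no G-semiregular secant design at `n ≡ 0 (mod 4)`): a seed on a member of ANY eightfold component `(4, d, δ)` —
split or not — WOULD give that component ∧ EVERY ℚ(√−d)-Weil SIXFOLD and FOURFOLD (`WeilAlgebraicAll 3 d`, `WeilAlgebraicAll 2 d`) ∧ every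
SIXFOLD CELL `(3, d, δ')` — the non-split, deciding g = 6 cells included (s4-bridge-2's `weilClassesComponent_three_of_four` is the bare
class-target step). No printed instance ([Markman2025SurveySecant] §12, an expectation); no census object.
[cite: Schoen1998HodgeWeilAddendum, 10 (Proposition), p. 332] [cite: Markman2025SurveySecant, §11.5 Steps 1–2 and §12 (preprint)]
[cite: Deligne1982HodgeCycles, proof of Thm. 4.8] -/
theorem eightfoldComponent_and_below_of_reach_of_localVariationalHodgeFor_of_seedOn_member (hF : weilFamilyReach_similar)
    (hT : LocalVariationalHodgeFor 𝒪) {d : ℕ} {δ : weilNormResidueGroup d}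
    {P : AbelianVariety ℂ} {ψ₀ : P ⟶ P} (hW : IsWeilType P ψ₀ 4 d) (e : ProjectiveEmbedding P.X)
    {a : complexBetti (projectiveSpace e.n ℂ) 2} (haQ : IsRationalClass a) (ha0 : a ≠ 0)
    (hδ : HasWeilDiscriminantNondeg P ψ₀ 4 d (symmetrisedClass d P ψ₀ e a) δ)
    {w : complexBetti P.X 8} (hwW : w ∈ weilClassesOf P ψ₀ 4 d) (hwQ : IsRationalClass w) (hw0 : w ≠ 0)
    (hS : HasSeedOn 𝒪 4 P (symmetrisedClass d P ψ₀ e a) w) :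
    WeilClassesComponent 4 d δ ∧ WeilAlgebraicAll 3 d ∧ WeilAlgebraicAll 2 d ∧
      ∀ δ' : weilNormResidueGroup d, WeilClassesComponent 3 d δ' :=
  have h := componentLadder_of_localVariationalHodgeFor_of_seedOn_member hF hT hW e haQ ha0 hδ hwW hwQ hw0 hS
  ⟨h.1, h.2.2 3 three_pos (by norm_num), h.2.2 2 two_pos (by norm_num), h.2.1 3 three_pos (by norm_num)⟩

/-- **`N = 5` — a g = 10 row on ANY tenfold component** (VERDICT-G6 v1.0 § g = 10 ∕ family S: «no witness»; STRUCTURE (S4): the first rung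
where an extremal class-alive secant factor is expected): a seed on a member of ANY component `(5, d, δ)` WOULD give that component ∧ EVERY
ℚ(√−d)-Weil eightfold, sixfold and fourfold ∧ every eightfold and sixfold cell. No printed instance; no census object.
[cite: Schoen1998HodgeWeilAddendum, 10 (Proposition), p. 332] [cite: Markman2025SurveySecant, §4 and §12 (preprint)]
[cite: Deligne1982HodgeCycles, proof of Thm. 4.8] -/
theorem tenfoldComponent_and_below_of_reach_of_localVariationalHodgeFor_of_seedOn_member (hF : weilFamilyReach_similar)
    (hT : LocalVariationalHodgeFor 𝒪) {d : ℕ} {δ : weilNormResidueGroup d}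
    {P : AbelianVariety ℂ} {ψ₀ : P ⟶ P} (hW : IsWeilType P ψ₀ 5 d) (e : ProjectiveEmbedding P.X)
    {a : complexBetti (projectiveSpace e.n ℂ) 2} (haQ : IsRationalClass a) (ha0 : a ≠ 0)
    (hδ : HasWeilDiscriminantNondeg P ψ₀ 5 d (symmetrisedClass d P ψ₀ e a) δ)
    {w : complexBetti P.X 10} (hwW : w ∈ weilClassesOf P ψ₀ 5 d) (hwQ : IsRationalClass w) (hw0 : w ≠ 0)
    (hS : HasSeedOn 𝒪 5 P (symmetrisedClass d P ψ₀ e a) w) :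
    WeilClassesComponent 5 d δ ∧ WeilAlgebraicAll 4 d ∧ WeilAlgebraicAll 3 d ∧ WeilAlgebraicAll 2 d ∧
      (∀ δ' : weilNormResidueGroup d, WeilClassesComponent 4 d δ') ∧ ∀ δ' : weilNormResidueGroup d, WeilClassesComponent 3 d δ' :=
  have h := componentLadder_of_localVariationalHodgeFor_of_seedOn_member hF hT hW e haQ ha0 hδ hwW hwQ hw0 hS
  ⟨h.1, h.2.2 4 four_pos (by norm_num), h.2.2 3 three_pos (by norm_num), h.2.2 2 two_pos (by norm_num),
    h.2.1 4 four_pos (by norm_num), h.2.1 3 three_pos (by norm_num)⟩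

/-- **`N = 6` — the (S4) rung on ANY twelvefold component** (S4-PUSH, R-104: K-dimension 6; s4-bridge-2's `weilClassesComponent_of_six` is
the bare class-target step, s4-bridge-1's `TwelvefoldDoor.lean` the split-anchored door): a seed on a member of ANY component `(6, d, δ)` WOULD
give that component and, for EVERY rank `1 ≤ m ≤ 5`, every component `(m, d, δ')` and `WeilAlgebraicAll m d` — all ℚ(√−d)-Weil abelian
varieties of dimension ≤ 10. No printed instance; no object. [cite: Schoen1998HodgeWeilAddendum, 10 (Proposition), p. 332]
[cite: Markman2025SurveySecant, §12 (preprint)] [cite: Deligne1982HodgeCycles, proof of Thm. 4.8] -/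
theorem twelvefoldComponent_and_below_of_reach_of_localVariationalHodgeFor_of_seedOn_member (hF : weilFamilyReach_similar)
    (hT : LocalVariationalHodgeFor 𝒪) {d : ℕ} {δ : weilNormResidueGroup d}
    {P : AbelianVariety ℂ} {ψ₀ : P ⟶ P} (hW : IsWeilType P ψ₀ 6 d) (e : ProjectiveEmbedding P.X)
    {a : complexBetti (projectiveSpace e.n ℂ) 2} (haQ : IsRationalClass a) (ha0 : a ≠ 0)
    (hδ : HasWeilDiscriminantNondeg P ψ₀ 6 d (symmetrisedClass d P ψ₀ e a) δ)
    {w : complexBetti P.X 12} (hwW : w ∈ weilClassesOf P ψ₀ 6 d) (hwQ : IsRationalClass w) (hw0 : w ≠ 0)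
    (hS : HasSeedOn 𝒪 6 P (symmetrisedClass d P ψ₀ e a) w) :
    WeilClassesComponent 6 d δ ∧
      ∀ m : ℕ, 0 < m → m ≤ 5 → WeilAlgebraicAll m d ∧ ∀ δ' : weilNormResidueGroup d, WeilClassesComponent m d δ' :=
  have h := componentLadder_of_localVariationalHodgeFor_of_seedOn_member hF hT hW e haQ ha0 hδ hwW hwQ hw0 hS
  ⟨h.1, fun m hm hm5 ↦ ⟨h.2.2 m hm (by omega), h.2.1 m hm (by omega)⟩⟩

end Readings

/-! ## §5 The signed § g = 6 ∕ § g = 8 ∕ § g = 10 words as ONE conjunction each: certified negative ∧ the component ladder a passing row WOULD give -/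

section Census

variable {𝒪 : ObjClass}

/-- **§ V-1 (g = 6) with the LADDER half of a deciding row.** (a) DATA: the three-outcome form on the deciding rows of the g = 6 census of
record reads «NO-in-families-tried» (`CensusG6.outcome_g6`, seat p11: no deciding row is SEMIREG ∧ CLASS, no all-object barrier row).
(b) CONDITIONAL: BY NAME `weilFamilyReach_similar` and `LocalVariationalHodgeFor 𝒪`, a seed of class `𝒪` on a member of ANY sixfold cell
`(3, d, δ)` WOULD give `WeilClassesComponent 3 d δ` AND `WeilAlgebraicAll 2 d` AND every fourfold cell. p11 g2's
`g6_noInFamiliesTried_and_conditional` is (a) ∧ the first conjunct of (b). Nothing instantiated.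
[bookkeeping ∧ cite: Schoen1998HodgeWeilAddendum, 10 (Proposition), p. 332] [cite: Deligne1982HodgeCycles, proof of Thm. 4.8] -/
theorem g6_noInFamiliesTried_and_componentLadder (hF : weilFamilyReach_similar) (hT : LocalVariationalHodgeFor 𝒪) :
    CensusG6.outcome CensusG6.census = .noInFamiliesTried ∧
      ∀ (d : ℕ) (δ : weilNormResidueGroup d) (P : AbelianVariety ℂ) (ψ₀ : P ⟶ P) (_ : IsWeilType P ψ₀ 3 d)
        (e : ProjectiveEmbedding P.X) (a : complexBetti (projectiveSpace e.n ℂ) 2) (_ : IsRationalClass a) (_ : a ≠ 0)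
        (_ : HasWeilDiscriminantNondeg P ψ₀ 3 d (symmetrisedClass d P ψ₀ e a) δ)
        (w : complexBetti P.X 6) (_ : w ∈ weilClassesOf P ψ₀ 3 d) (_ : IsRationalClass w) (_ : w ≠ 0),
        HasSeedOn 𝒪 3 P (symmetrisedClass d P ψ₀ e a) w →
          WeilClassesComponent 3 d δ ∧ WeilAlgebraicAll 2 d ∧ ∀ δ' : weilNormResidueGroup d, WeilClassesComponent 2 d δ' :=
  ⟨CensusG6.outcome_g6, fun _ _ _ _ hW e _ haQ ha0 hδ _ hwW hwQ hw0 hS ↦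
    sixfoldComponent_and_fourfolds_of_reach_of_localVariationalHodgeFor_of_seedOn_member hF hT hW e haQ ha0 hδ hwW hwQ hw0 hS⟩

/-- **§ g = 8 with the LADDER half of a DECIDING row** (the kernel form of «ALL g = 8 rows are DECIDING» for the g = 6 question). (a) DATA:
seat p9's certified negative over the g = 8 census of record — the three-outcome form reads «NO-in-families-tried» (`CensusG8.outcome_g8`:
no n = 4 row is CLASS-EXACT ∧ SEMIREGULAR, no all-object barrier row). (b) CONDITIONAL: BY NAME `weilFamilyReach_similar` and
`LocalVariationalHodgeFor 𝒪`, a seed of class `𝒪` on a member of ANY eightfold component `(4, d, δ)` — the non-split (deciding) ones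
included, unlike p11 g0's split-anchored `g8_noInFamiliesTried_and_conditional` — WOULD give that component, every ℚ(√−d)-Weil sixfold and
fourfold, and every sixfold cell `(3, d, δ')`. Nothing instantiated. [bookkeeping ∧ cite: Schoen1998HodgeWeilAddendum, 10 (Proposition), p. 332]
[cite: Markman2025SurveySecant, §11.5 Steps 1–2 and §12 (preprint)] [cite: Deligne1982HodgeCycles, proof of Thm. 4.8] -/
theorem g8_noInFamiliesTried_and_componentLadder (hF : weilFamilyReach_similar) (hT : LocalVariationalHodgeFor 𝒪) :
    CensusG8.outcome CensusG8.census = .noInFamiliesTried ∧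
      ∀ (d : ℕ) (δ : weilNormResidueGroup d) (P : AbelianVariety ℂ) (ψ₀ : P ⟶ P) (_ : IsWeilType P ψ₀ 4 d)
        (e : ProjectiveEmbedding P.X) (a : complexBetti (projectiveSpace e.n ℂ) 2) (_ : IsRationalClass a) (_ : a ≠ 0)
        (_ : HasWeilDiscriminantNondeg P ψ₀ 4 d (symmetrisedClass d P ψ₀ e a) δ)
        (w : complexBetti P.X 8) (_ : w ∈ weilClassesOf P ψ₀ 4 d) (_ : IsRationalClass w) (_ : w ≠ 0),
        HasSeedOn 𝒪 4 P (symmetrisedClass d P ψ₀ e a) w →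
          WeilClassesComponent 4 d δ ∧ WeilAlgebraicAll 3 d ∧ WeilAlgebraicAll 2 d ∧
            ∀ δ' : weilNormResidueGroup d, WeilClassesComponent 3 d δ' :=
  ⟨CensusG8.outcome_g8, fun _ _ _ _ hW e _ haQ ha0 hδ _ hwW hwQ hw0 hS ↦
    eightfoldComponent_and_below_of_reach_of_localVariationalHodgeFor_of_seedOn_member hF hT hW e haQ ha0 hδ hwW hwQ hw0 hS⟩

/-- **§ g = 10 ∕ FAMILY S with the LADDER half on ANY tenfold component** («family S, n = 5: no witness»). (a) DATA: in the g = 10 census of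
record no n = 5 row — on a non-split component OR on the split (ladder) component — is class-exact ∧ W-alive ∧ semiregular
(`CensusG10.no_semireg_and_class_at_g10`, seat p11). (b) CONDITIONAL: BY NAME `weilFamilyReach_similar` and `LocalVariationalHodgeFor 𝒪`,
a seed of class `𝒪` on a member of ANY component `(5, d, δ)` WOULD give that component, every ℚ(√−d)-Weil eightfold, sixfold and fourfold,
and every eightfold and sixfold cell — which is why a family-S witness (split (5, K) component) or any other n = 5 row would have decided
the cell's g = 6 ∕ g = 8 questions; p11 g2's `g10_noWitness_and_ladderConditional` is the split-anchored form. Nothing instantiated.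
[bookkeeping ∧ cite: Schoen1998HodgeWeilAddendum, 10 (Proposition), p. 332] [cite: Deligne1982HodgeCycles, proof of Thm. 4.8] -/
theorem g10_noWitness_and_componentLadder (hF : weilFamilyReach_similar) (hT : LocalVariationalHodgeFor 𝒪) :
    (∀ r ∈ CensusG10.census, r.atFive = true → r.semiregAndClass = false) ∧
      ∀ (d : ℕ) (δ : weilNormResidueGroup d) (P : AbelianVariety ℂ) (ψ₀ : P ⟶ P) (_ : IsWeilType P ψ₀ 5 d)
        (e : ProjectiveEmbedding P.X) (a : complexBetti (projectiveSpace e.n ℂ) 2) (_ : IsRationalClass a) (_ : a ≠ 0)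
        (_ : HasWeilDiscriminantNondeg P ψ₀ 5 d (symmetrisedClass d P ψ₀ e a) δ)
        (w : complexBetti P.X 10) (_ : w ∈ weilClassesOf P ψ₀ 5 d) (_ : IsRationalClass w) (_ : w ≠ 0),
        HasSeedOn 𝒪 5 P (symmetrisedClass d P ψ₀ e a) w →
          WeilClassesComponent 5 d δ ∧ WeilAlgebraicAll 4 d ∧ WeilAlgebraicAll 3 d ∧ WeilAlgebraicAll 2 d ∧
            (∀ δ' : weilNormResidueGroup d, WeilClassesComponent 4 d δ') ∧
            ∀ δ' : weilNormResidueGroup d, WeilClassesComponent 3 d δ' :=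
  ⟨CensusG10.no_semireg_and_class_at_g10, fun _ _ _ _ hW e _ haQ ha0 hδ _ hwW hwQ hw0 hS ↦
    tenfoldComponent_and_below_of_reach_of_localVariationalHodgeFor_of_seedOn_member hF hT hW e haQ ha0 hδ hwW hwQ hw0 hS⟩

end Census

/-! ## Audit: nothing is decided here
§1 is bookkeeping between the OPEN typed class targets `WeilClassesComponent` ∕ `WeilAlgebraicAll` (s4-bridge-2's Schoen ladder re-indexed;
no named fact). §2–§4 carry the SEED by value and, BY NAME, Deligne's reach-by-similitude (REFEREED named fact, undischarged) and the
transfer statement of the object class (for route (C) the venture's ASSUMPTIONS `PerfectComplexRankTransfer C` ∕ `PerfectComplexSigmaTransfer C`,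
or Pridham's printed statement + the Hodge-free algebraisation shape — none kernel-linked to its printed legs). §5's data halves are the
`decide` theorems of seats p11 ∕ p9 about the transcribed census tables (target-g6/CENSUS.md v3.77, target-g8/CENSUS.md v1.273,
target-g10/CENSUS.md v1.25) — statements about tables, not about varieties. `HC_CM`, CM density, Mumford–Tate finiteness do not occur;
no terminus beyond the typed class targets is claimed; NOT `HC_AV`. 0 `def`, 0 named fact introduced, 0 `sorry`. -/

end Summit.Ventures.HSemireg

end
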